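import Mathlib
import Literature.Barriers.ValiantsHypothesis.FullRankMultilinearProofs

/-!
# Route BarrierLever — crux `DefinableEquations` (stmt-8745) / item `SingleSizeEquations`
# (stmt-8749): the FULL-RANK METHOD WALL AT `b = 2`, part 1 — the matched product
# `∏_k (y_k + z_k)` and the generic product of `n` linear forms (val-np-p5 g14)

Preliminaries for `…FullRankMethodWallTwo.lean` (the wall of Raz's full-rank / min-partition-rank
method against the crux's class `SmallCircuits ℂ (2n) 2`).  Contents, in the vocabulary of the
tree's proof of Raz–Yehudayoff Thm. 4.2 (`RazYehudayoff.FullRk`, `FullRk.mul`, `cM`, `eY`, `eZ`,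
`injective_mulVec_cM`, `det_cM_map_rename`):

* §0 `fullRk_X_add_X` — the coefficient matrix of the linear form `x_a + x_b` with respect to
  `({a}, {b})` is `(0 1; 1 0)`, of full rank (the tree has `1 + x_a x_b ↦ (1 0; 0 1)`);
* §1 `matchedProd A = ∏_{k<n} (x_{A⁻¹ y_k} + x_{A⁻¹ z_k})` for a partition
  `A : Fin 2n ≃ Fin n ⊕ Fin n`; `fullRk_matchedProd` (Kronecker product of `n` copies of
  `(0 1; 1 0)`: the permutation matrix `p ↦ {z_k : y_k ∉ p}`), `det_cM_matchedProd_ne_zero`;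
* §2 `linProd n a = ∏_{k<n} ∑_{i<2n} a_{k,i} x_i` (any coefficient table `a`, any commutative
  semiring), the generic one `genericLinProd` over `ℂ[a]`, `map_linProd`, the matching point
  `matchPt A` (`a_{k,i} = [x_i ∈ {y_k, z_k}]`) with `linProd_matchPt : linProd (matchPt A) = P_A`,
  and **`det_cM_generic_ne_zero`**: every cut determinant of the generic product is a NONZERO
  element of `ℂ[a]` (it specialises to `det M_{P_A^A} ≠ 0`); `prod_det_cM_generic_ne_zero`.

Honest scope: tools only; the wall and its reading are in part 2.  Nothing here bears on the crux
(`b = 2` OPEN) or on `VP ≠ VNP`.  No `Prop` definitions (three explicit polynomial/point `def`s),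
no named facts, standard axioms.  Refs: Raz–Yehudayoff, Comput. Complexity 17 (2008) §4.2.2,
§4.3.1 (eq. (4.2)), Thm. 4.2.
-/

-- `Summit.ValiantsHypothesis.ValiantsHypothesis.…` repeats a component by the D-0017 layout
-- (single-conjunct summit), which the `dupNamespace` linter flags; the name is mandated.
set_option linter.dupNamespace false

noncomputable section

namespace Summit.ValiantsHypothesis.ValiantsHypothesis.Theorems.BarrierLeverDefinableEquations

open MvPolynomial
open Literature.Computability.AlgebraicComplexity hiding IsSyntacticallyMultilinear smCircuitSize
open Literature.Barriers.ValiantsHypothesis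
open Literature.Barriers.ValiantsHypothesis.RazYehudayoff
open scoped BigOperators

namespace FullRankMethodWallTwo

/-! ## §0 The base matrix `M_{y + z} = (0 1; 1 0)` and products of crossing pairs -/

section Base

variable {S : Type*} [CommSemiring S] {σ : Type*} [DecidableEq σ]

/-- "`Rank(M_{y + z}) = 2`": for `a ≠ b` the coefficient matrix of the linear form `x_a + x_b`
with respect to `({a}, {b})` is the anti-diagonal `2 × 2` permutation matrix (entries
`coeff 1 = 0`, `coeff x_b = 1`, `coeff x_a = 1`, `coeff x_a x_b = 0`), hence of full rank.
[cite: RazYehudayoff2008, §4.2.2 and §4.3.1 (Case one, mutatis mutandis)] -/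
theorem fullRk_X_add_X {a b : σ} (hab : a ≠ b) :
    FullRk (X a + X b : MvPolynomial σ S) {a} {b} := by
  intro v hv V' hV'
  have hpow : ({b} : Finset σ).powerset = {∅, {b}} := by
    ext s
    simp [Finset.subset_singleton_iff]
  have hne : (∅ : Finset σ) ≠ {b} := (Finset.singleton_ne_empty b).symm
  have hsb : (Finsupp.single a 1 + Finsupp.single b 1 : σ →₀ ℕ) ≠ Finsupp.single b 1 := by
    intro h
    have := DFunLike.congr_fun h a
    simp [Ne.symm hab] at this
  have hsa : (Finsupp.single a 1 + Finsupp.single b 1 : σ →₀ ℕ) ≠ Finsupp.single a 1 := by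
    intro h
    have := DFunLike.congr_fun h b
    simp [hab] at this
  have h0b : (0 : σ →₀ ℕ) ≠ Finsupp.single b 1 := by
    intro h
    have := DFunLike.congr_fun h b
    simp at this
  have h0a : (0 : σ →₀ ℕ) ≠ Finsupp.single a 1 := by
    intro h
    have := DFunLike.congr_fun h a
    simp at this
  have hba : (Finsupp.single b 1 : σ →₀ ℕ) ≠ Finsupp.single a 1 := by
    intro h
    have := DFunLike.congr_fun h a
    simp [Ne.symm hab] at this
  have c00 : coeff (ind ((∅ : Finset σ) ∪ ∅)) (X a + X b : MvPolynomial σ S) = 0 := by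
    rw [Finset.empty_union, ind_empty, coeff_add, coeff_X, coeff_X, if_neg h0a.symm,
      if_neg h0b.symm, add_zero]
  have c0b : coeff (ind ((∅ : Finset σ) ∪ {b})) (X a + X b : MvPolynomial σ S) = 1 := by
    rw [Finset.empty_union, ind_singleton, coeff_add, coeff_X, coeff_X, if_neg hba.symm,
      if_pos rfl, zero_add]
  have ca0 : coeff (ind (({a} : Finset σ) ∪ ∅)) (X a + X b : MvPolynomial σ S) = 1 := by
    rw [Finset.union_empty, ind_singleton, coeff_add, coeff_X, coeff_X, if_pos rfl,
      if_neg hba, add_zero]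
  have cab : coeff (ind (({a} : Finset σ) ∪ {b})) (X a + X b : MvPolynomial σ S) = 0 := by
    rw [ind_union (Finset.disjoint_singleton.2 hab), ind_singleton, ind_singleton, coeff_add,
      coeff_X, coeff_X, if_neg hsa.symm, if_neg hsb.symm, add_zero]
  have e0 := hv ∅ (Finset.empty_subset _)
  have ea := hv {a} (Finset.Subset.refl _)
  rw [hpow, Finset.sum_pair hne] at e0 ea
  rw [c00, c0b] at e0
  rw [ca0, cab] at ea
  simp only [one_mul, zero_mul, add_zero, zero_add] at e0 ea
  rcases Finset.subset_singleton_iff.1 hV' with h | h <;> rw [h]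
  · exact ea
  · exact e0

end Base

/-! ## §1 The matched product `∏_k (y_k + z_k)` of a partition is of full rank -/

section Matched

variable {n : ℕ} (A : Fin (2 * n) ≃ Fin n ⊕ Fin n)

/-- The matched product of the partition `A`: `P_A = ∏_{k < n} (x_{A⁻¹(y_k)} + x_{A⁻¹(z_k)})`,
over any commutative semiring. [cite: RazYehudayoff2008, §4.3.1 (the Kronecker-product step)] -/
def matchedProd (S : Type*) [CommSemiring S] : MvPolynomial (Fin (2 * n)) S :=
  ∏ k : Fin n, (X (eY A k) + X (eZ A k))

/-- `y`- and `z`-positions never coincide. [folklore] -/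
theorem eY_ne_eZ (k l : Fin n) : eY A k ≠ eZ A l := by
  intro h
  have h' : A.symm (Sum.inl k) = A.symm (Sum.inr l) := h
  exact Sum.inl_ne_inr (A.symm.injective h')

/-- Partial matched products are of full rank with respect to their own `y`- and `z`-positions
(induction on the set of factors by `FullRk.mul`). [cite: RazYehudayoff2008, §4.3.1 (eq. (4.2))] -/
theorem fullRk_matchedProd_finset (S : Type*) [CommSemiring S] [Nontrivial S] (J : Finset (Fin n)) :
    FullRk (∏ k ∈ J, (X (eY A k) + X (eZ A k) : MvPolynomial (Fin (2 * n)) S))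
      (J.map (eY A)) (J.map (eZ A)) := by
  classical
  induction J using Finset.induction_on with
  | empty => simpa using (fullRk_one : FullRk (1 : MvPolynomial (Fin (2 * n)) S) ∅ ∅)
  | insert k J hk ih =>
    rw [Finset.prod_insert hk, Finset.map_insert, Finset.map_insert]
    have hW : Disjoint ({eY A k, eZ A k} : Finset (Fin (2 * n))) (J.map (eY A) ∪ J.map (eZ A)) := by
      rw [Finset.disjoint_left]
      intro i hi hi'
      simp only [Finset.mem_insert, Finset.mem_singleton] at hi
      rcases Finset.mem_union.1 hi' with h | h
      · obtain ⟨l, hl, rfl⟩ := Finset.mem_map.1 h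
        rcases hi with h1 | h1
        · exact hk (by rwa [(eY A).injective h1] at hl)
        · exact eY_ne_eZ A l k h1
      · obtain ⟨l, hl, rfl⟩ := Finset.mem_map.1 h
        rcases hi with h1 | h1
        · exact eY_ne_eZ A k l h1.symm
        · exact hk (by rwa [(eZ A).injective h1] at hl)
    have hg₁ : (X (eY A k) + X (eZ A k) : MvPolynomial (Fin (2 * n)) S) ∈
        supported S (↑({eY A k, eZ A k} : Finset (Fin (2 * n))) : Set (Fin (2 * n))) := by
      refine Subalgebra.add_mem _ ?_ ?_ <;>
        exact (X_mem_supported).2 (by simp)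
    have hg₂ : (∏ l ∈ J, (X (eY A l) + X (eZ A l) : MvPolynomial (Fin (2 * n)) S)) ∈
        supported S (↑(J.map (eY A) ∪ J.map (eZ A)) : Set (Fin (2 * n))) := by
      refine Subalgebra.prod_mem _ fun l hl => Subalgebra.add_mem _ ?_ ?_
      · exact (X_mem_supported).2 (by simp [hl])
      · exact (X_mem_supported).2 (by simp [hl])
    have hmul := FullRk.mul (U₁ := {eY A k}) (V₁ := {eZ A k}) (U₂ := J.map (eY A))
      (V₂ := J.map (eZ A)) hW hg₁ hg₂ (by simp) (by simp) Finset.subset_union_left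
      Finset.subset_union_right (fullRk_X_add_X (eY_ne_eZ A k k)) ih
    rw [Finset.insert_eq, Finset.insert_eq (eZ A k)]
    exact hmul

/-- **The matched product is of full rank** with respect to all `y`- and all `z`-positions of
`A` (its coefficient matrix is the permutation matrix `p ↦ {z_k : y_k ∉ p}`). [cite: RazYehudayoff2008, §4.2.2] -/
theorem fullRk_matchedProd (S : Type*) [CommSemiring S] [Nontrivial S] :
    FullRk (matchedProd A S) (Finset.univ.map (eY A)) (Finset.univ.map (eZ A)) :=
  fullRk_matchedProd_finset A S Finset.univ

/-- Hence, over a field, the partial-derivative matrix of `P_A^A` is nonsingular. [cite: RazYehudayoff2008, Thm. 4.2 (mechanism)] -/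
theorem det_cM_matchedProd_ne_zero (K : Type*) [Field K] :
    (cM (rename A (matchedProd A K))).det ≠ 0 := by
  classical
  have hinj := injective_mulVec_cM A (matchedProd A K) (fullRk_matchedProd A K)
  have hU := Matrix.mulVec_injective_iff_isUnit.1 hinj
  rw [Matrix.isUnit_iff_isUnit_det, isUnit_iff_ne_zero] at hU
  exact hU

end Matched

/-! ## §2 The product of `n` GENERIC linear forms: every cut determinant is a nonzero polynomial
in the `n · 2n` coefficients -/

section Generic

variable (n : ℕ)

/-- The parameters: `a_{k,i}`, the coefficient of `x_i` in the `k`-th linear form. [folklore] -/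
abbrev Par (n : ℕ) : Type := Fin n × Fin (2 * n)

/-- **The product of `n` linear forms** `∏_{k < n} (∑_{i < 2n} a_{k,i} x_i)` with coefficient
table `a`, over any commutative semiring (a homogeneous `ΠΣ` circuit of degree `n` in `2n`
variables). [folklore] -/
def linProd {R : Type*} [CommSemiring R] (a : Fin n → Fin (2 * n) → R) :
    MvPolynomial (Fin (2 * n)) R :=
  ∏ k : Fin n, ∑ i : Fin (2 * n), C (a k i) * X i

/-- The GENERIC product: coefficients the variables `a_{k,i}` of `ℂ[a]`. [folklore] -/
def genericLinProd : MvPolynomial (Fin (2 * n)) (MvPolynomial (Par n) ℂ) :=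
  linProd n fun k i => X (k, i)

/-- Ring maps act on the coefficient table. [folklore] -/
theorem map_linProd {R₁ R₂ : Type*} [CommSemiring R₁] [CommSemiring R₂] (φ : R₁ →+* R₂)
    (a : Fin n → Fin (2 * n) → R₁) :
    MvPolynomial.map φ (linProd n a) = linProd n fun k i => φ (a k i) := by
  unfold linProd
  rw [map_prod]
  refine Finset.prod_congr rfl fun k _ => ?_
  rw [map_sum]
  refine Finset.sum_congr rfl fun i _ => ?_
  rw [map_mul, map_C, map_X]

variable {n}

/-- The matching point of a partition `A`: `a_{k,i} = 1` iff `x_i` is `y_k` or `z_k` under `A`,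
else `0`. [folklore] -/
def matchPt (A : Fin (2 * n) ≃ Fin n ⊕ Fin n) : Par n → ℂ :=
  fun p => if p.2 = eY A p.1 ∨ p.2 = eZ A p.1 then 1 else 0

/-- At the matching point the product of linear forms IS the matched product `∏_k (y_k + z_k)`.
[folklore] -/
theorem linProd_matchPt (A : Fin (2 * n) ≃ Fin n ⊕ Fin n) :
    linProd n (fun k i => matchPt A (k, i)) = matchedProd A ℂ := by
  classical
  unfold linProd matchedProd
  refine Finset.prod_congr rfl fun k _ => ?_
  have hne : eY A k ≠ eZ A k := eY_ne_eZ A k k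
  rw [Finset.sum_eq_add_of_mem (eY A k) (eZ A k) (Finset.mem_univ _) (Finset.mem_univ _) hne]
  · simp only [matchPt, true_or, or_true, if_true, C_1, one_mul]
  · intro i _ hi
    simp only [matchPt]
    rw [if_neg (not_or.2 ⟨hi.1, hi.2⟩), C_0, zero_mul]

/-- **Every cut determinant of the generic product is a nonzero polynomial in the coefficients**:
it specialises, at the matching point of the cut, to the nonzero determinant of the matched
product. [cite: RazYehudayoff2008, Thm. 4.2 (mechanism: specialisation of the determinant)] -/
theorem det_cM_generic_ne_zero (A : Fin (2 * n) ≃ Fin n ⊕ Fin n) :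
    (cM (rename A (genericLinProd n))).det ≠ 0 := by
  classical
  intro h0
  have h := det_cM_map_rename A (eval (matchPt A)) (genericLinProd n)
  rw [h0, map_zero, genericLinProd, map_linProd] at h
  simp only [eval_X] at h
  rw [linProd_matchPt A] at h
  exact det_cM_matchedProd_ne_zero A ℂ h

variable (n) in
/-- The product over all `binom(2n,n) · …` ordered partitions of the cut determinants is a
nonzero polynomial in the coefficients (`ℂ[a]` is a domain). [folklore] -/
theorem prod_det_cM_generic_ne_zero :
    (∏ A : Fin (2 * n) ≃ Fin n ⊕ Fin n, (cM (rename A (genericLinProd n))).det) ≠ 0 :=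
  Finset.prod_ne_zero_iff.2 fun A _ => det_cM_generic_ne_zero A

end Generic

end FullRankMethodWallTwo

end Summit.ValiantsHypothesis.ValiantsHypothesis.Theorems.BarrierLeverDefinableEquations
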